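import Summits.Ventures.PercRepro.Night2LocalD2R14Defs
import Summits.Ventures.PercRepro.Night2LocalD2KOneB

/-!
# PercRepro — the columns of R1₄ at the bases (night-2, gen 15)

The first column bound of the rule R1₄ (Night2LocalD2R14Defs) in the coloop cell `|E ∖ G| = 2`, `kColoops = 1` of the
(6,4) row: at a shadow set `S` with `|S| = 5` — `S = U ∪ {y}` with `U` a basis of `P = G ∖ y` — the column is
`keep(U)·[U a member] + Σ_{z ∈ U, (U ∖ z) ∪ {y} a member} r14Cov ≤ keep(U) + σ⁺(U) ≤ 1`
(`sum_r14W_col_le_of_card_five`): no pair set or spread set has five elements, the only covering preimage with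
`|G ∖ cl B| = 1` is `U` itself (a covering preimage `S ∖ z`, `z ≠ y`, contains `y` and would make `z` a coloop of
`P`, excluded by `hP`), and the covering preimages `S ∖ z`, `z ∈ U`, are the faces counted by `σ⁺(U)`.

Hypotheses on the coloop: `y ∈ G`, `y ∉ cl(G ∖ y)`, and `P = G ∖ y` has no coloop (`ρ(P ∖ z) ≥ 4` for `z ∈ P`) — the
`kColoops = 1` situation of the row (a coloop of `M|P` would be a second coloop of `M|G`).
-/

namespace PercRepro.Shadow

open Finset PerFlat ThmH

variable {α : Type*} [DecidableEq α] {M : Matroid α} [M.Finite]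

omit [DecidableEq α] in
/-- Membership in `clF` as membership in the closure. -/
theorem mem_clF_iff {X : Finset α} {e : α} : e ∈ clF M X ↔ e ∈ M.closure (X : Set α) := by
  rw [← Finset.mem_coe, coe_clF]

/-- Exchange at the coloop `y`: for `X ⊆ G ∖ y` and `p ∈ G ∖ y`, `p ∈ cl(X ∪ {y})` forces `p ∈ cl X`. -/
theorem mem_clF_of_mem_clF_insert_coloop {G : Finset α} {y : α} (hyc : y ∉ clF M (G.erase y)) {X : Finset α}
    (hX : X ⊆ G.erase y) {p : α} (hp : p ∈ G.erase y) (h : p ∈ clF M (insert y X)) : p ∈ clF M X := by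
  by_contra hpX
  rw [mem_clF_iff] at hpX h
  rw [Finset.coe_insert] at h
  have hy := Matroid.mem_closure_insert hpX h
  apply hyc
  rw [mem_clF_iff]
  have hsub : (insert p (X : Set α)) ⊆ ((G.erase y : Finset α) : Set α) := by
    rw [← Finset.coe_insert]
    exact_mod_cast Finset.insert_subset hp hX
  exact M.closure_subset_closure hsub hy

omit [DecidableEq α] in
/-- The rank of a rank-`(q+1)` flat. -/
theorem rkN_eq_of_mem_flatsQ {q : ℕ} {G : Finset α} (hG : G ∈ flatsQ M (q + 1)) : rkN M G = q + 1 := by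
  unfold rkN
  rw [(mem_flatsQ.1 hG).2.2]
  rfl

/-- A point outside the closure of `X ⊆ E` raises the rank: `ρ(insert y X) = ρ X + 1`. -/
theorem rkN_insert_eq_add_one_of_notMem_clF {X : Finset α} (hX : X ⊆ gr M) {y : α} (hyE : y ∈ gr M)
    (hy : y ∉ clF M X) : rkN M (insert y X) = rkN M X + 1 := by
  have h1 := rkN_erase_ge (M := M) (insert y X) y
  have hyX : y ∉ X := fun h => hy (subset_clF_of_subset_gr hX h)
  rw [Finset.erase_insert hyX] at h1
  have h2 : rkN M X ≤ rkN M (insert y X) := rkN_mono (Finset.subset_insert _ _)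
  by_contra hne
  have heq : rkN M X = rkN M (insert y X) := by omega
  have hcl := subset_closure_of_rkN_eq (M := M) (Finset.insert_subset hyE hX) (Finset.subset_insert _ _) heq
  apply hy
  rw [mem_clF_iff]
  exact hcl (by simp)

/-- `ρ(G ∖ y) = q` for a coloop `y` of the rank-`(q+1)` flat `G`. -/
theorem rkN_erase_eq_of_coloop {q : ℕ} {G : Finset α} (hG : G ∈ flatsQ M (q + 1)) {y : α} (hyG : y ∈ G)
    (hyc : y ∉ clF M (G.erase y)) : rkN M (G.erase y) = q := by
  have hGg : G ⊆ gr M := (mem_flatsQ.1 hG).1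
  have h := rkN_insert_eq_add_one_of_notMem_clF (M := M) (Finset.erase_subset _ _ |>.trans hGg) (hGg hyG) hyc
  rw [Finset.insert_erase hyG, rkN_eq_of_mem_flatsQ hG] at h
  omega

/-- A member containing the coloop `y` has `|G ∖ cl B| ≥ 2` when `P = G ∖ y` has no coloop. -/
theorem two_le_card_sdiff_clF_of_mem_coloop {G : Finset α} (hG : G ∈ flatsQ M (4 + 1)) {y : α} (hyG : y ∈ G)
    (hyc : y ∉ clF M (G.erase y)) (hP : ∀ z ∈ G.erase y, 4 ≤ rkN M ((G.erase y).erase z)) {B : Finset α}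
    (hB : B ∈ membersIn M (Uq M (4 + 2) 4) G) (hyB : y ∈ B) : 2 ≤ (G \ clF M B).card := by
  have hGg : G ⊆ gr M := (mem_flatsQ.1 hG).1
  have hBU : B ∈ Uq M (4 + 2) 4 := (mem_membersIn.1 hB).1
  have hBG : B ⊆ G := (subset_clF hBU).trans (mem_membersIn.1 hB).2
  have hrB := rkN_eq_of_mem_Uq hBU
  have hBy : B.erase y ⊆ G.erase y := Finset.erase_subset_erase _ hBG
  -- `ρ(B ∖ y) = 3`
  have hr3 : rkN M (B.erase y) = 3 := by
    have hycl : y ∉ clF M (B.erase y) := fun h => hyc (clF_mono hBy h)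
    have h := rkN_insert_eq_add_one_of_notMem_clF (M := M) (hBy.trans (Finset.erase_subset _ _ |>.trans hGg))
      (hGg hyG) hycl
    rw [Finset.insert_erase hyB, hrB] at h
    omega
  by_contra hlt
  push Not at hlt
  -- `G ∖ cl B = {z}` for one point `z ≠ y` of `G`; then `P ∖ z ⊆ cl(B ∖ y)` has rank `≤ 3`
  have hpos : 0 < (G \ clF M B).card := by
    rw [Finset.card_pos]
    by_contra hemp
    rw [Finset.not_nonempty_iff_eq_empty, Finset.sdiff_eq_empty_iff_subset] at hemp
    have h1 := rkN_mono (M := M) hemp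
    rw [rkN_clF_eq_of_mem_Uq hBU, rkN_eq_of_mem_flatsQ hG] at h1
    omega
  obtain ⟨z, hz⟩ := Finset.card_eq_one.1 (by omega : (G \ clF M B).card = 1)
  have hzmem : z ∈ G \ clF M B := by rw [hz]; exact Finset.mem_singleton_self z
  have hzG : z ∈ G := (Finset.mem_sdiff.1 hzmem).1
  have hzy : z ≠ y := by
    rintro rfl
    exact (Finset.mem_sdiff.1 hzmem).2 (subset_clF hBU hyB)
  have hzP : z ∈ G.erase y := Finset.mem_erase.2 ⟨hzy, hzG⟩
  have hsub : (G.erase y).erase z ⊆ clF M (B.erase y) := by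
    intro p hp
    rw [Finset.mem_erase] at hp
    have hpP : p ∈ G.erase y := hp.2
    have hpcl : p ∈ clF M B := by
      by_contra hpc
      have : p ∈ G \ clF M B := Finset.mem_sdiff.2 ⟨(Finset.mem_erase.1 hpP).2, hpc⟩
      rw [hz, Finset.mem_singleton] at this
      exact hp.1 this
    rw [← Finset.insert_erase hyB] at hpcl
    exact mem_clF_of_mem_clF_insert_coloop hyc hBy hpP hpcl
  have h1 := rkN_le_of_subset_clF' (M := M) hsub
  have h2 := hP z hzP
  omega

open scoped Classical in
/-- The `m = 1` covering preimages of a shadow set `S` with `|S| = 5` … in fact of any shadow set: a covering preimage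
`S ∖ z` with `|G ∖ cl B| = 1` is `S ∖ y`. -/
theorem eq_erase_coloop_of_coverPreimage_card_one {G : Finset α} (hG : G ∈ flatsQ M (4 + 1)) {y : α} (hyG : y ∈ G)
    (hyc : y ∉ clF M (G.erase y)) (hP : ∀ z ∈ G.erase y, 4 ≤ rkN M ((G.erase y).erase z)) {S B : Finset α}
    (hB : B ∈ coverPreimages M (Uq M (4 + 2) 4) G S) (hm : (G \ clF M B).card = 1) (hyS : y ∈ S) :
    B = S.erase y := by
  obtain ⟨hBm, hcov⟩ := mem_coverPreimages.1 hB
  have hBU : B ∈ Uq M (4 + 2) 4 := (mem_membersIn.1 hBm).1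
  obtain ⟨z, hz, rfl⟩ := mem_coverSets.1 hcov
  have hzB : z ∉ B := notMem_of_notMem_clF hBU (Finset.mem_sdiff.1 hz).2
  have hyB : y ∉ B := by
    intro hyB
    have := two_le_card_sdiff_clF_of_mem_coloop hG hyG hyc hP hBm hyB
    omega
  have hzy : z = y := by
    rw [Finset.mem_insert] at hyS
    rcases hyS with h | h
    · exact h.symm
    · exact absurd h hyB
  subst hzy
  rw [Finset.erase_insert hzB]

/-- `S ∖ y` has `|G ∖ cl (S ∖ y)| ≤ 1` … we only need: a member `U ⊆ G ∖ y` has `G ∖ cl U = {y}`. -/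
theorem sdiff_clF_eq_singleton_of_subset_erase {G : Finset α} (hG : G ∈ flatsQ M (4 + 1)) {y : α} (hyG : y ∈ G)
    (hyc : y ∉ clF M (G.erase y)) {U : Finset α} (hU : U ∈ membersIn M (Uq M (4 + 2) 4) G) (hUy : U ⊆ G.erase y) :
    G \ clF M U = {y} := by
  have hGg : G ⊆ gr M := (mem_flatsQ.1 hG).1
  have hUU : U ∈ Uq M (4 + 2) 4 := (mem_membersIn.1 hU).1
  have hr := rkN_erase_eq_of_coloop hG hyG hyc
  have hrU := rkN_eq_of_mem_Uq hUU
  have hcl : G.erase y ⊆ clF M U := by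
    have h := subset_closure_of_rkN_eq (M := M) (Finset.erase_subset _ _ |>.trans hGg) hUy (by omega)
    intro e he
    rw [mem_clF_iff]
    exact h (Finset.mem_coe.2 he)
  ext e
  rw [Finset.mem_sdiff, Finset.mem_singleton]
  constructor
  · rintro ⟨heG, hecl⟩
    by_contra hey
    exact hecl (hcl (Finset.mem_erase.2 ⟨hey, heG⟩))
  · rintro rfl
    exact ⟨hyG, fun h => hyc (clF_mono hUy h)⟩

open scoped Classical in
/-- **The column of R1₄ at a five-element shadow set** (`S = U ∪ {y}`, `U` a basis of `G ∖ y`) is at most `1`. -/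
theorem sum_r14W_col_le_of_card_five {G : Finset α} (hG : G ∈ flatsQ M (4 + 1))
    {y : α} (hyG : y ∈ G) (hyc : y ∉ clF M (G.erase y)) (hP : ∀ z ∈ G.erase y, 4 ≤ rkN M ((G.erase y).erase z))
    {S : Finset α} (hS : S ∈ shadowAt M (4 + 2) 4 (Uq M (4 + 2) 4) G) (h5 : S.card = 5) :
    ∑ B ∈ membersIn M (Uq M (4 + 2) 4) G, r14W M G B S ≤ 1 := by
  have hGg : G ⊆ gr M := (mem_flatsQ.1 hG).1
  have hSG : S ⊆ G := subset_of_mem_shadowAt hS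
  have hyS : y ∈ S := mem_of_mem_shadowAt_of_coloop (by rw [rkN_erase_eq_of_coloop hG hyG hyc]) hS
  set U := S.erase y with hUdef
  have hUS : U ⊆ S := Finset.erase_subset _ _
  have hUy : U ⊆ G.erase y := Finset.erase_subset_erase _ hSG
  have hU4 : U.card = 4 := by rw [hUdef, Finset.card_erase_of_mem hyS, h5]
  have hSU : S = insert y U := (Finset.insert_erase hyS).symm
  -- every member has at least four elements
  have hcard4 : ∀ B ∈ membersIn M (Uq M (4 + 2) 4) G, 4 ≤ B.card := by
    intro B hB
    have := rkN_le_card_fin (M := M) B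
    rw [rkN_eq_of_mem_Uq (mem_membersIn.1 hB).1] at this
    exact this
  -- the per-member bound
  have hbound : ∀ B ∈ membersIn M (Uq M (4 + 2) 4) G, r14W M G B S ≤
      (if B = U then r14Keep M G U else 0) +
      (if S ∈ coverSets M B G ∧ ¬ (G \ clF M B).card = 1 then r14Cov M G B else 0) := by
    intro B hB
    have hBU : B ∈ Uq M (4 + 2) 4 := (mem_membersIn.1 hB).1
    have hB4 := hcard4 B hB
    -- pair sets and spread sets have at least six elements
    have hpair : ∀ P ∈ Finset.powersetCard 2 (G \ clF M B), S ≠ B ∪ P := by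
      intro P hP hSP
      rw [Finset.mem_powersetCard] at hP
      have hdisj : Disjoint B P := by
        rw [Finset.disjoint_left]
        intro e heB heP
        exact (Finset.mem_sdiff.1 (hP.1 heP)).2 (subset_clF hBU heB)
      have := Finset.card_union_of_disjoint hdisj
      rw [← hSP, h5, hP.2] at this
      omega
    have hm1 : 1 ≤ (G \ clF M B).card := by
      by_contra h
      push Not at h
      have h0 : G \ clF M B = ∅ := Finset.card_eq_zero.1 (by omega)
      rw [Finset.sdiff_eq_empty_iff_subset] at h0
      have h1 := rkN_mono (M := M) h0
      rw [rkN_clF_eq_of_mem_Uq hBU, rkN_eq_of_mem_flatsQ hG] at h1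
      omega
    have hdisjB : Disjoint B (G \ clF M B) := by
      rw [Finset.disjoint_left]
      intro e heB he
      exact (Finset.mem_sdiff.1 he).2 (subset_clF hBU heB)
    have hspread : ∀ x ∈ clF M B \ B, S ≠ insert x (B ∪ (G \ clF M B)) := by
      intro x hx hSx
      rw [Finset.mem_sdiff] at hx
      have hxn : x ∉ B ∪ (G \ clF M B) := by
        rw [Finset.mem_union, Finset.mem_sdiff]
        push Not
        exact ⟨hx.2, fun _ => hx.1⟩
      have h1 := Finset.card_insert_of_notMem hxn
      have h2 := Finset.card_union_of_disjoint hdisjB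
      rw [← hSx, h5] at h1
      omega
    unfold r14W
    simp only [hB, if_true]
    by_cases hm : (G \ clF M B).card = 1
    · simp only [hm, if_true, not_true_eq_false, and_false, if_false, add_zero]
      by_cases hcov : S ∈ coverSets M B G
      · -- `B` is the `m = 1` covering preimage `U`
        have hBeq : B = U := eq_erase_coloop_of_coverPreimage_card_one hG hyG hyc hP
          (mem_coverPreimages.2 ⟨hB, hcov⟩) hm hyS
        have h5U : ¬ 5 ≤ U.card := by rw [hU4]; norm_num
        have hsum : ∑ x ∈ clF M B \ B, (if S = insert x (B ∪ (G \ clF M B)) then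
            (2 / 5 - r14Keep M G B) / ((clF M B \ B).card : ℚ) else 0) = 0 := by
          apply Finset.sum_eq_zero
          intro x hx
          simp only [hspread x hx, if_false]
        rw [hsum, add_zero, hBeq] at *
        simp only [h5U, if_false]
        split_ifs <;> simp [r14Keep_nonneg]
      · simp only [hcov, if_false, zero_add]
        have hsum : ∑ x ∈ clF M B \ B, (if S = insert x (B ∪ (G \ clF M B)) then
            (2 / 5 - r14Keep M G B) / ((clF M B \ B).card : ℚ) else 0) = 0 := by
          apply Finset.sum_eq_zero
          intro x hx
          simp only [hspread x hx, if_false]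
        rw [hsum]
        split_ifs <;> simp [r14Keep_nonneg]
    · simp only [hm, if_false, not_false_eq_true, and_true]
      have hsum : ∑ P ∈ Finset.powersetCard 2 (G \ clF M B), (if S = B ∪ P then r14Pair M G B else 0) = 0 := by
        apply Finset.sum_eq_zero
        intro P hP
        simp only [hpair P hP, if_false]
      rw [hsum, add_zero]
      have hBne : B ≠ U := by
        intro hBeq
        apply hm
        rw [hBeq, sdiff_clF_eq_singleton_of_subset_erase hG hyG hyc (hBeq ▸ hB) hUy, Finset.card_singleton]
      simp only [hBne, if_false, zero_add, le_refl]
  -- sum the per-member bounds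
  have hsplit := Finset.sum_le_sum hbound
  rw [Finset.sum_add_distrib] at hsplit
  -- the keep part
  have hkeep : ∑ B ∈ membersIn M (Uq M (4 + 2) 4) G, (if B = U then r14Keep M G U else 0) =
      if U ∈ membersIn M (Uq M (4 + 2) 4) G then r14Keep M G U else 0 := Finset.sum_ite_eq' _ _ _
  -- the covering part is at most the face sum
  have hcov : ∑ B ∈ membersIn M (Uq M (4 + 2) 4) G,
      (if S ∈ coverSets M B G ∧ ¬ (G \ clF M B).card = 1 then r14Cov M G B else 0) ≤
      ∑ z ∈ U, (if S.erase z ∈ membersIn M (Uq M (4 + 2) 4) G then r14Cov M G (S.erase z) else 0) := by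
    -- the nonzero terms are indexed by `B = S ∖ z`, `z ∈ U` with `S ∖ z` a member
    have himg : (membersIn M (Uq M (4 + 2) 4) G).filter
        (fun B => S ∈ coverSets M B G ∧ ¬ (G \ clF M B).card = 1) ⊆
        (U.filter (fun z => S.erase z ∈ membersIn M (Uq M (4 + 2) 4) G)).image (fun z => S.erase z) := by
      intro B hB
      rw [Finset.mem_filter] at hB
      obtain ⟨hBm, hcov, hm⟩ := hB
      obtain ⟨z, hz, rfl⟩ := mem_coverSets.1 hcov
      have hBU : B ∈ Uq M (4 + 2) 4 := (mem_membersIn.1 hBm).1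
      have hzB : z ∉ B := notMem_of_notMem_clF hBU (Finset.mem_sdiff.1 hz).2
      have hzy : z ≠ y := by
        rintro rfl
        apply hm
        have hBy : B ⊆ G.erase z := by
          intro e he
          rw [Finset.mem_erase]
          exact ⟨fun h => hzB (h ▸ he), (subset_clF hBU).trans (mem_membersIn.1 hBm).2 he⟩
        rw [sdiff_clF_eq_singleton_of_subset_erase hG hyG hyc hBm hBy, Finset.card_singleton]
      have hzU : z ∈ U := by
        rw [hUdef, Finset.mem_erase]
        exact ⟨hzy, Finset.mem_insert_self _ _⟩
      have hBz : (insert z B).erase z = B := Finset.erase_insert hzB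
      rw [Finset.mem_image]
      refine ⟨z, ?_, hBz⟩
      rw [Finset.mem_filter, hBz]
      exact ⟨hzU, hBm⟩
    have hinj : Set.InjOn (fun z => S.erase z) ((U.filter (fun z => S.erase z ∈ membersIn M (Uq M (4 + 2) 4) G)) : Set α) := by
      intro z hz z' hz' h
      have hzS : z ∈ S := hUS (Finset.mem_filter.1 (Finset.mem_coe.1 hz)).1
      have hz'S : z' ∈ S := hUS (Finset.mem_filter.1 (Finset.mem_coe.1 hz')).1
      by_contra hne
      have h' : S.erase z = S.erase z' := h
      have : z' ∈ S.erase z := Finset.mem_erase.2 ⟨Ne.symm hne, hz'S⟩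
      rw [h'] at this
      exact (Finset.mem_erase.1 this).1 rfl
    calc ∑ B ∈ membersIn M (Uq M (4 + 2) 4) G,
          (if S ∈ coverSets M B G ∧ ¬ (G \ clF M B).card = 1 then r14Cov M G B else 0)
        = ∑ B ∈ (membersIn M (Uq M (4 + 2) 4) G).filter
            (fun B => S ∈ coverSets M B G ∧ ¬ (G \ clF M B).card = 1), r14Cov M G B := by
          rw [Finset.sum_filter]
      _ ≤ ∑ B ∈ (U.filter (fun z => S.erase z ∈ membersIn M (Uq M (4 + 2) 4) G)).image (fun z => S.erase z),
            r14Cov M G B :=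
          Finset.sum_le_sum_of_subset_of_nonneg himg (fun B _ _ => r14Cov_nonneg G B)
      _ = ∑ z ∈ U.filter (fun z => S.erase z ∈ membersIn M (Uq M (4 + 2) 4) G), r14Cov M G (S.erase z) :=
          Finset.sum_image hinj
      _ = ∑ z ∈ U, (if S.erase z ∈ membersIn M (Uq M (4 + 2) 4) G then r14Cov M G (S.erase z) else 0) := by
          rw [Finset.sum_filter]
  -- the face sum is at most `4 · 6/35`, and equals `σ⁺(U)` when `U` is a member
  have hface_le : ∑ z ∈ U, (if S.erase z ∈ membersIn M (Uq M (4 + 2) 4) G then r14Cov M G (S.erase z) else 0) ≤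
      24 / 35 := by
    calc ∑ z ∈ U, (if S.erase z ∈ membersIn M (Uq M (4 + 2) 4) G then r14Cov M G (S.erase z) else 0)
        ≤ ∑ z ∈ U, (6 / 35 : ℚ) := by
          apply Finset.sum_le_sum
          intro z _
          split_ifs
          · exact r14Cov_le G _
          · norm_num
      _ = 24 / 35 := by rw [Finset.sum_const, hU4, nsmul_eq_mul]; norm_num
  rw [hkeep] at hsplit
  have htotal : ∑ B ∈ membersIn M (Uq M (4 + 2) 4) G, r14W M G B S ≤
      (if U ∈ membersIn M (Uq M (4 + 2) 4) G then r14Keep M G U else 0) +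
      ∑ z ∈ U, (if S.erase z ∈ membersIn M (Uq M (4 + 2) 4) G then r14Cov M G (S.erase z) else 0) := by
    linarith
  by_cases hUm : U ∈ membersIn M (Uq M (4 + 2) 4) G
  · simp only [hUm, if_true] at htotal
    have hsig : ∑ z ∈ U, (if S.erase z ∈ membersIn M (Uq M (4 + 2) 4) G then r14Cov M G (S.erase z) else 0) =
        r14Sigma M G U := by
      unfold r14Sigma
      rw [sdiff_clF_eq_singleton_of_subset_erase hG hyG hyc hUm hUy]
      apply Finset.sum_congr rfl
      intro z hz
      have hzy : z ≠ y := (Finset.mem_erase.1 (hUy hz)).1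
      have hSz : S.erase z = U.erase z ∪ {y} := by
        rw [hSU, Finset.erase_insert_of_ne hzy.symm, Finset.insert_eq, Finset.union_comm]
      rw [hSz]
    rw [hsig] at htotal hface_le
    have hkeep_le : r14Keep M G U ≤ 1 - r14Sigma M G U := by
      unfold r14Keep
      apply max_le
      · linarith
      · exact min_le_right _ _
    linarith
  · simp only [hUm, if_false, zero_add] at htotal
    linarith

end PercRepro.Shadow
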